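import Mathlib.LinearAlgebra.Semisimple
import Mathlib.LinearAlgebra.Matrix.ToLin
import Mathlib.RingTheory.Ideal.Quotient.Basic
import Summits.HodgeConjecture.HodgeConjecture.Theorems.K2E3OrbitClosureSemisimpleTransport
import HarnessLib

/-!
# K2 · E3 ∕ U12-d, road (S-d) file 3b kit — semisimplicity of a matrix passes along a SURJECTIVE ring homomorphism of the
# coefficients, in particular to each COMPONENT of a matrix over a product ring `Π i, K i`

HCML Track B «K2-LIT», cell `pub/hodgecm-mathlib`, crux H413 = `stmt-HodgeConjecture-24833` (`--supports … --as helper`), seat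
`hodgecm-mathlib-K2E3-p19` (g2), for socket #12 `sig_K2E3NormalizedCharBddNearSemisimple`, sub-socket U12-d₂ `sig_K2E3CayleySliceConjugatesNhds`
(file 3b `K2E3CayleySliceConjugatesNhds`, K2E3-p12's MEMO `MEMO-U12d-Sd-road.v2` — the «EXTRA LEMMA» of its split-place branch).  The socket states
semisimplicity of `s ∈ U_N(H)(L⁺_v)` as `Module.End.IsSemisimple (toLin' MAT(s))` over the coefficient ring `R = L ⊗ L⁺_v = Π_{w ∣ v} L_w`; at a SPLIT
place the chart lives over ONE factor `L_w`, reached by the component projection `Pi.evalRingHom _ w : R →+* L_w`, which is SURJECTIVE but not an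
isomorphism — so neither ★ `K2E3SemisimpleMatrixRingEquivTransfer.isSemisimple_toLin'_map_ringEquiv` (ring iso) nor
★ `K2E3OrbitClosureSemisimpleTransport.isSemisimple_toLin'_map_iff` (bijective `φ`) applies, and ★ `…isSemisimple_toLin'_pi` is the converse direction.

THIS FILE (theorems only, no `sorry`, axioms ⊆ the trio):
* §1 `isSemisimple_of_semilinear_surjective` — a SURJECTIVE `σ`-semilinear intertwiner (`σ` surjective) carries semisimplicity of `f` to `g`
  (invariant submodules pull back by `comap`, an invariant complement pushes forward by `map`; `Module.End.isSemisimple_iff`);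
* §2 **`isSemisimple_toLin'_map_of_surjective`** — for `f : R →+* S` surjective and `A ∈ M_n(R)`: `toLin' A` semisimple ⇒ `toLin' (A.map f)` semisimple
  (apply §1 to `x ↦ f ∘ x : Rⁿ → Sⁿ`, `RingHom.map_mulVec`);
* §3 corollaries: components over a product ring `isSemisimple_toLin'_map_evalRingHom` and the iff `isSemisimple_toLin'_pi_iff` (with ★ `isSemisimple_toLin'_pi`),
  binary products `isSemisimple_toLin'_map_fst` ∕ `…_snd`, quotient rings `isSemisimple_toLin'_map_quotientMk`.
HONEST LABEL: linear algebra; HC_CM is proved only modulo the 7 printed citations (2 remaining named inputs: hLiu418 = stmt-HodgeConjecture-24832,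
h413 = stmt-HodgeConjecture-24833) until rung 0 closes.

## References
* [Borel1991] A. Borel, *Linear Algebraic Groups*, 2nd ed. (1991), I.4 (4.2–4.4) (semisimple endomorphisms, functoriality).
* N. Bourbaki, *Algèbre* VIII §9 (semisimple endomorphisms) — folklore.
-/

set_option autoImplicit false
set_option linter.dupNamespace false

namespace Summit.HodgeConjecture.HodgeConjecture.Cruxes.H413.K2E3SemisimpleMatrixSurjectiveTransfer

open Module Module.End

/-! ## §1 Surjective semilinear intertwiners -/

section Semilinear

variable {R S M N : Type*} [CommRing R] [CommRing S] [AddCommGroup M] [Module R M] [AddCommGroup N] [Module S N]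
  {σ : R →+* S} [RingHomSurjective σ]

/-- **Semisimplicity descends along a surjective semilinear intertwiner**: if `l : M →ₛₗ[σ] N` is surjective (`σ` surjective) and
`l ∘ f = g ∘ l`, then `f` semisimple ⇒ `g` semisimple.  A `g`-invariant `q ≤ N` pulls back to the `f`-invariant `l⁻¹ q`; an `f`-invariant
complement `p'` of it maps to the `g`-invariant complement `l p'` of `q` (disjoint: `l x ∈ q`, `x ∈ p'` ⇒ `x ∈ l⁻¹ q ∩ p' = 0`; spanning: `l` is onto).
[cite: Borel1991, I.4 (4.2–4.4)] -/
theorem isSemisimple_of_semilinear_surjective (l : M →ₛₗ[σ] N) (hl : Function.Surjective l) {f : End R M} {g : End S N}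
    (h : ∀ x, l (f x) = g (l x)) (hf : f.IsSemisimple) : g.IsSemisimple := by
  rw [isSemisimple_iff] at hf ⊢
  intro q hq
  have hq' : q.comap l ∈ f.invtSubmodule := by
    rw [mem_invtSubmodule_iff_forall_mem_of_mem] at hq ⊢
    intro x hx
    rw [Submodule.mem_comap] at hx ⊢
    rw [h]
    exact hq _ hx
  obtain ⟨p', hp', hc⟩ := hf _ hq'
  refine ⟨p'.map l, ?_, ⟨?_, ?_⟩⟩
  · rw [mem_invtSubmodule_iff_forall_mem_of_mem] at hp' ⊢
    rintro _ ⟨x, hx, rfl⟩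
    rw [← h]
    exact Submodule.mem_map_of_mem (hp' x hx)
  · rw [Submodule.disjoint_def]
    rintro _ hyq ⟨x, hx, rfl⟩
    have hx0 : x ∈ q.comap l ⊓ p' := ⟨hyq, hx⟩
    rw [hc.inf_eq_bot, Submodule.mem_bot] at hx0
    rw [hx0, map_zero]
  · rw [codisjoint_iff, eq_top_iff]
    rintro y -
    obtain ⟨x, rfl⟩ := hl y
    have hx : x ∈ q.comap l ⊔ p' := by rw [hc.sup_eq_top]; exact Submodule.mem_top
    obtain ⟨a, ha, b, hb, rfl⟩ := Submodule.mem_sup.1 hx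
    rw [map_add]
    exact Submodule.add_mem_sup ha (Submodule.mem_map_of_mem hb)

end Semilinear

/-! ## §2 Matrices: `A ↦ A.map f` for a surjective ring homomorphism `f` -/

section MatrixMap

variable {R S : Type*} [CommRing R] [CommRing S] {n : Type*} [Fintype n] [DecidableEq n]

/-- The `f`-semilinear coordinate map `x ↦ f ∘ x : Rⁿ → Sⁿ` intertwines `toLin' A` and `toLin' (A.map f)` (`RingHom.map_mulVec`). [folklore] -/
theorem toLin'_map_apply_comp (f : R →+* S) (A : Matrix n n R) (x : n → R) :
    Matrix.toLin' (A.map f) (fun i => f (x i)) = fun i => f (Matrix.toLin' A x i) := by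
  funext i
  rw [Matrix.toLin'_apply, Matrix.toLin'_apply]
  exact (RingHom.map_mulVec f A x i).symm

/-- **Semisimplicity of a matrix passes along a surjective ring homomorphism of the coefficients**: for `f : R →+* S` surjective and
`A ∈ M_n(R)`, `toLin' A` semisimple over `R` ⇒ `toLin' (A.map f)` semisimple over `S` (§1 applied to `x ↦ f ∘ x`).  The typical uses: `S = R ⧸ I`,
or `S` = one factor of a product ring `R = Π i, K i`. [cite: Borel1991, I.4 (4.2–4.4)] -/
theorem isSemisimple_toLin'_map_of_surjective (f : R →+* S) (hf : Function.Surjective f) (A : Matrix n n R)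
    (hA : Module.End.IsSemisimple (Matrix.toLin' A)) : Module.End.IsSemisimple (Matrix.toLin' (A.map f)) := by
  haveI : RingHomSurjective f := ⟨hf⟩
  let l : (n → R) →ₛₗ[f] (n → S) :=
    { toFun := fun x i => f (x i)
      map_add' := fun x y => funext fun i => map_add f (x i) (y i)
      map_smul' := fun c x => funext fun i => by simp only [Pi.smul_apply, smul_eq_mul, map_mul] }
  have hl : Function.Surjective l := fun y => by
    choose x hx using fun i => hf (y i)
    exact ⟨x, funext hx⟩
  refine isSemisimple_of_semilinear_surjective l hl (f := Matrix.toLin' A) (g := Matrix.toLin' (A.map f)) (fun x => ?_) hA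
  change (fun i => f (Matrix.toLin' A x i)) = Matrix.toLin' (A.map f) (fun i => f (x i))
  exact (toLin'_map_apply_comp f A x).symm

/-- Quotient rings: `toLin' A` semisimple over `R` ⇒ `toLin' (A mod I)` semisimple over `R ⧸ I`. [cite: Borel1991, I.4 (4.2–4.4)] -/
theorem isSemisimple_toLin'_map_quotientMk (I : Ideal R) (A : Matrix n n R) (hA : Module.End.IsSemisimple (Matrix.toLin' A)) :
    Module.End.IsSemisimple (Matrix.toLin' (A.map (Ideal.Quotient.mk I))) :=
  isSemisimple_toLin'_map_of_surjective _ Ideal.Quotient.mk_surjective A hA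

/-- Binary products, first factor: `toLin' A` semisimple over `R × S` ⇒ its `R`-component is semisimple. [cite: Borel1991, I.4 (4.2–4.4)] -/
theorem isSemisimple_toLin'_map_fst (A : Matrix n n (R × S)) (hA : Module.End.IsSemisimple (Matrix.toLin' A)) :
    Module.End.IsSemisimple (Matrix.toLin' (A.map (RingHom.fst R S))) :=
  isSemisimple_toLin'_map_of_surjective _ Prod.fst_surjective A hA

/-- Binary products, second factor: `toLin' A` semisimple over `R × S` ⇒ its `S`-component is semisimple. [cite: Borel1991, I.4 (4.2–4.4)] -/
theorem isSemisimple_toLin'_map_snd (A : Matrix n n (R × S)) (hA : Module.End.IsSemisimple (Matrix.toLin' A)) :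
    Module.End.IsSemisimple (Matrix.toLin' (A.map (RingHom.snd R S))) :=
  isSemisimple_toLin'_map_of_surjective _ Prod.snd_surjective A hA

end MatrixMap

/-! ## §3 Matrices over a product ring `Π i, K i`: components -/

section PiRing

variable {ι : Type*} {K : ι → Type*} [∀ i, CommRing (K i)] {n : Type*} [Fintype n] [DecidableEq n]

/-- **Each component of a semisimple matrix over `Π i, K i` is semisimple**: `toLin' A` semisimple over the product ring ⇒
`toLin' (A.map (Pi.evalRingHom K i))` semisimple over `K i` (the component projection is surjective).  This is the direction used at a SPLIT place
`v` of `L⁺`, where `L ⊗ L⁺_v = L_w × L_{w̄}` and the chart is built over the single factor `L_w`. [cite: Borel1991, I.4 (4.2–4.4)] -/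
theorem isSemisimple_toLin'_map_evalRingHom (A : Matrix n n (Π i, K i)) (hA : Module.End.IsSemisimple (Matrix.toLin' A)) (i : ι) :
    Module.End.IsSemisimple (Matrix.toLin' (A.map (Pi.evalRingHom K i))) :=
  isSemisimple_toLin'_map_of_surjective _ (Function.surjective_eval i) A hA

/-- **Semisimplicity over a finite product ring is exactly componentwise semisimplicity** (⇒ by `isSemisimple_toLin'_map_evalRingHom`,
⇐ by ★ `K2E3OrbitClosureSemisimpleTransport.isSemisimple_toLin'_pi`). [cite: Borel1991, I.4 (4.2–4.4)] -/
theorem isSemisimple_toLin'_pi_iff [Fintype ι] [DecidableEq ι] (A : Matrix n n (Π i, K i)) :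
    Module.End.IsSemisimple (Matrix.toLin' A) ↔ ∀ i, Module.End.IsSemisimple (Matrix.toLin' (A.map (Pi.evalRingHom K i))) :=
  ⟨fun hA i => isSemisimple_toLin'_map_evalRingHom A hA i, K2E3OrbitClosureSemisimpleTransport.isSemisimple_toLin'_pi A⟩

end PiRing

end Summit.HodgeConjecture.HodgeConjecture.Cruxes.H413.K2E3SemisimpleMatrixSurjectiveTransfer
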